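import Summits.BirchSwinnertonDyer.BirchSwinnertonDyer.Theses.PrintX11a
import HarnessLib

/-!
# Route `PrintX11a` (cell `bsd-print-x11a`, seat p3): the three fact-free GLUE items of rev 8 BY NAME —
# `X11aNonSurjEulerHalfOfParts` (item stmt-BirchSwinnertonDyer-20615), `PrintInputsX11aOfParts` (item 20569),
# `Assembly` (item 20405)

Planner g2's TURNKEY BACK (PLAN v3 §2 p3 (1), STATUS 16:28Z): after the split of crux 20406 into `UpperNonSurjThree` (20613) |
`UpperNonSurjFive` (20614) and of the support `PrintInputsX11a` (20407) into its three named facts, the route carries three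
bookkeeping items whose statements are implications between route decls. Each is proved here by a closed term:

* `x11aNonSurjEulerHalfOfParts_holds : UpperNonSurjThree → UpperNonSurjFive → X11aNonSurjEulerHalf` — the registered-stub glue
  (`ClassX11a` carries `p ≠ 2`; a prime `∉ {2,3}` is `≥ 5`); the same term as
  `Theorems.x11aNonSurjEulerHalf_of_three_of_five` (p539522, `Theorems/PrintX11aNonSurjEulerHalfOfMu.lean`), re-proved inline so
  that this module sits directly on the route file (theses-cone hygiene); lossless by `x11aNonSurjEulerHalf_parts_of` (p539522) /
  `X11a.nonSurjEulerHalf_iff_three_and_five_le` (ty2, p541325).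
* `printInputsX11aOfParts_holds : WuthrichShaDividesAnalyticSha → RankEqAnalyticRankLeOne → NewformOfEllipticCurve → PrintInputsX11a`
  — the anonymous constructor.
* `assembly_holds : X11aLowerHalf → X11aNonSurjEulerHalf → PrintInputsX11a → WAllCornerX11a` — the route's deciding theorem
  `Theses.PrintX11a.closes` itself (two-halves glue, p3 g0's `x11aTarget_of_lowerHalf_of_nonSurjEulerHalf` inlined by the planner).

HONEST FRAMING. Three theorems, no definition, no named fact, no `sorry`; FACT-FREE (no Literature hypothesis); they close only the
glue/assembly items — the cruxes `X11aLowerHalf` (19064), `UpperNonSurjThree` (20613), `UpperNonSurjFive` (20614) and the three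
fact items stay exactly as open as before; the leaf `ClassX11a` is NOT closed; BSD is not advanced. «beyond-print theorem: NO».
-/

set_option autoImplicit false
set_option linter.dupNamespace false

namespace Summit.BirchSwinnertonDyer.BirchSwinnertonDyer.Theorems

open Summit.BirchSwinnertonDyer.BirchSwinnertonDyer.Theses.PrintX11a

/-- **Item stmt-BirchSwinnertonDyer-20615 `X11aNonSurjEulerHalfOfParts`**: the `p = 3` part and the `p ≥ 5` part of the
Euler-system half at the non-surjective X11a pairs give the whole (an X11a pair has `p ≠ 2`, and a prime other than `2, 3`
is `≥ 5`). Fact-free; the term of `Theorems.x11aNonSurjEulerHalf_of_three_of_five`. [cite: Miller2011LMS, Def. 1.1 (shape of the halves)] -/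
theorem x11aNonSurjEulerHalfOfParts_holds :
    Summit.BirchSwinnertonDyer.BirchSwinnertonDyer.Theses.PrintX11a.X11aNonSurjEulerHalfOfParts := by
  intro h₃ h₅ W _ _ p _ hX hns
  by_cases h3 : p = 3
  · exact h₃ W p hX hns h3
  · have hpP : p.Prime := Fact.out
    have h2 : p ≠ 2 := hX.2.1
    have h2le := hpP.two_le
    have h4 : p ≠ 4 := fun h => by rw [h] at hpP; exact absurd hpP (by decide)
    exact h₅ W p hX hns (by omega)

/-- **Item stmt-BirchSwinnertonDyer-20569 `PrintInputsX11aOfParts`**: the three named facts (Wuthrich 2014 Prop. 21,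
Gross–Zagier–Kolyvagin, modularity) re-assemble into the support binder `PrintInputsX11a` — the anonymous constructor.
Fact-free bookkeeping. [cite: Wuthrich2014, Prop. 21 (p. 400) (shape only)] -/
theorem printInputsX11aOfParts_holds :
    Summit.BirchSwinnertonDyer.BirchSwinnertonDyer.Theses.PrintX11a.PrintInputsX11aOfParts :=
  fun h₁ h₂ h₃ => ⟨h₁, h₂, h₃⟩

/-- **Item stmt-BirchSwinnertonDyer-20405 `Assembly`**: `X11aLowerHalf → X11aNonSurjEulerHalf → PrintInputsX11a →
WAllCornerX11a` is the route's deciding theorem `closes` (the two-halves glue onto the rung leaf W-ALL/11). Fact-free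
given its three hypotheses. [cite: Wuthrich2014, Prop. 21 (p. 400) (shape only)] [cite: Miller2011LMS, §1 and Def. 1.1] -/
theorem assembly_holds : Summit.BirchSwinnertonDyer.BirchSwinnertonDyer.Theses.PrintX11a.Assembly :=
  fun h₁ h₂ h₃ => Summit.BirchSwinnertonDyer.BirchSwinnertonDyer.Theses.PrintX11a.closes h₁ h₂ h₃

end Summit.BirchSwinnertonDyer.BirchSwinnertonDyer.Theorems
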